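import Mathlib
import HarnessLib
import Literature.Computability.AlgebraicComplexity.PatternExpressions
import Literature.Computability.AlgebraicComplexity.FormulaUnfolding
import Literature.Computability.AlgebraicComplexity.ValiantClassesProofs
import Summits.ValiantsHypothesis.ValiantsHypothesis.Theorems.MonotoneRestorationOrbitCompressionQPNarrowClosure

/-!
# Route MonotoneRestoration — aside `OrbitCompressionQP` (stmt-ValiantsHypothesis-18332), line
# `expression_compression`: the `VP`-MECHANISM for `stub_narrowExpressionCompression` —
# quasi-polynomial FORMULA SUBSTITUTION into pattern expressions (`VQP_e = VQP` transported)

The open stub of the line (`stub_narrowExpressionCompression`: a matrix-symmetric `VP` family that is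
narrow of SOME length is narrow of quasi-polynomial LENGTH) is false without `VP`
(`NarrowCompression.not_narrowExpressionCompression_without_VP`); of the two halves of `VP` only the
DEGREE half has been put to work so far (`CompressionFloors.narrowCompression_of_rowColSparse_VP`).  This
file puts the COMPLEXITY half to work, through the one theorem of the tree that turns small circuits into
small syntactic objects at the quasi-polynomial scale: Bürgisser–Clausen–Shokrollahi (21.33),
`VQP_e = VQP` (DISCHARGED in the tree: `isVQPeFamily_iff_isVQPFamily`, via the VSBR/Hyafil stage recursion),
read through the carrier bridge `exists_wexpr_size_le_formulaComplexity` (`FormulaUnfolding.lean`: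
fan-in-two formulas = weighted binary expressions `WExpr`).

* `exists_subst` (single level, any commutative semiring): a weighted binary expression `w` in variables
  `ι` and pattern expressions `θ i` (`k` row / `l` column labels) of length `≤ B` give ONE pattern
  expression of length `≤ 5|w| + (|w| + 1) B` whose value at every label assignment is
  `w(θ₁, θ₂, …)` evaluated there (`aeval`).  Pattern expressions are FORMULAS of the bipartite graph
  algebra, so substitution is literal and the length is linear in the formula size.
* ★ `exists_narrow_subst_of_isVQPFamily` (family level, over `ℂ`): for every `VQP` family
  `Q = (Q_n)`, `Q_n ∈ ℂ[y_1, …, y_{m(n)}]` (in particular every `VP` family,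
  `IsVPFamily.isVQPFamily`), and every family of substituends `θ_n : Fin (m n) → PatternExpr ℂ (k n) (l n)`
  of quasi-polynomial length, the composite `Q_n(θ_n)` is ONE pattern expression of quasi-polynomial length
  (value = `aeval (value ∘ θ_n) (Q_n)` at every assignment).  This is the substitution principle every
  attack on the stub through `VP ⇒ quasi-polynomial formulas` needs, with the balancing done once and for
  all by the tree's (21.33).
* ★ `narrowQP_rowPowerSumSubst` — THE ONE-ROW STRATUM IN POWER-SUM COORDINATES:
  `f_n = Σ_i Q_n(p_1(row i), …, p_{m(n)}(row i))`, `p_j(row i) = Σ_{j'} x_{ij'}^j`, is narrow of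
  quasi-polynomial length (`k = l = 1`) for every `VQP` family `Q`.  By Bläser–Jindal (ITCS 2019, Thm 4:
  `L(f) ≤ Õ(d² L(f_Sym) + d² n²)`) and Newton's identities, every member `Σ_i g_n(row i)` of the one-row
  stratum with `g_n` symmetric and `VP` is of this form with `Q ∈ VP`; that typing step (a named fact) is
  NOT done here — this file is the unconditional part, and the `VP` hypothesis is what it consumes.
* `narrowQP_fullPowerSumSubst` — the fully symmetric stratum `f_n = Q_n(P_1, …, P_{m(n)})`,
  `P_j = Σ_{i,j'} x_{ij'}^j`, likewise.

Helper file (`--supports stmt-ValiantsHypothesis-18332`); def-free; nothing here is a named fact; no stub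
of the registered skeleton is closed by it (stub 1 is refuted as registered, stub 2 is the open aside);
VP ≠ VNP is not moved.
-/

noncomputable section

open MvPolynomial

-- `Summit.ValiantsHypothesis.ValiantsHypothesis.…` is the tree's single-conjunct layout (Sub = Summit).
set_option linter.dupNamespace false

namespace Summit.ValiantsHypothesis.ValiantsHypothesis.Theorems

namespace FormulaSubstitution

open Literature.Computability.AlgebraicComplexity

/-! ### Single level: substituting pattern expressions into a weighted binary expression -/

section SingleLevel

variable {F : Type} [CommSemiring F] {k l : ℕ} {ι : Type}

/-- **Substitution engine.**  For a weighted binary expression `w` (the tree's carrier of fan-in-two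
formulas, `FormulaUnfolding.lean`) in variables `ι` and pattern expressions `θ i` of length `≤ B`
(`1 ≤ B`), there is a pattern expression of length `≤ 5 |w| + (|w| + 1) B` whose value at every label
assignment is `aeval (value ∘ θ) (w.eval)`: replace a leaf `y_i` by `θ i`, a constant by a constant, a
weighted sum `c₁ w₁ + c₂ w₂` by `add (mul (const c₁) ·) (mul (const c₂) ·)` and a product by `mul`.
[folklore] -/
theorem exists_subst (θ : ι → PatternExpr F k l) {B : ℕ} (hθ : ∀ i, (θ i).length ≤ B) (hB : 1 ≤ B) :
    ∀ w : WExpr F ι, ∃ e : PatternExpr F k l, e.length ≤ 5 * w.size + (w.size + 1) * B ∧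
      ∀ (n : ℕ) (ρ : Fin k → Fin n) (γ : Fin l → Fin n),
        e.value n ρ γ = aeval (fun i => (θ i).value n ρ γ) w.eval := by
  intro w
  induction w with
  | var i =>
    refine ⟨θ i, by simpa using hθ i, fun n ρ γ => ?_⟩
    simp
  | const c =>
    refine ⟨PatternExpr.const c, by simpa [PatternExpr.length] using hB, fun n ρ γ => ?_⟩
    simp [algebraMap_eq]
  | lin c₁ w₁ c₂ w₂ ih₁ ih₂ =>
    obtain ⟨e₁, hl₁, hv₁⟩ := ih₁
    obtain ⟨e₂, hl₂, hv₂⟩ := ih₂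
    refine ⟨PatternExpr.add (PatternExpr.mul (PatternExpr.const c₁) e₁)
        (PatternExpr.mul (PatternExpr.const c₂) e₂), ?_, fun n ρ γ => ?_⟩
    · simp only [PatternExpr.length, WExpr.size_lin]
      have : (w₁.size + w₂.size + 1 + 1) * B = (w₁.size + 1) * B + (w₂.size + 1) * B := by ring
      rw [this]
      omega
    · simp only [PatternExpr.value_add, PatternExpr.value_mul, PatternExpr.value_const, hv₁, hv₂,
        WExpr.eval_lin, smul_eq_C_mul, map_add, map_mul, aeval_C, algebraMap_eq]
  | mul w₁ w₂ ih₁ ih₂ =>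
    obtain ⟨e₁, hl₁, hv₁⟩ := ih₁
    obtain ⟨e₂, hl₂, hv₂⟩ := ih₂
    refine ⟨PatternExpr.mul e₁ e₂, ?_, fun n ρ γ => ?_⟩
    · simp only [PatternExpr.length, WExpr.size_mul]
      have : (w₁.size + w₂.size + 1 + 1) * B = (w₁.size + 1) * B + (w₂.size + 1) * B := by ring
      rw [this]
      omega
    · simp only [PatternExpr.value_mul, hv₁, hv₂, WExpr.eval_mul, map_mul]

/-- **Substitution at formula complexity**: if `E(q) ≤ s` (the tree's fan-in-two formula complexity) and
the substituends have length `≤ B`, `1 ≤ B`, then `q(θ)` is one pattern expression of length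
`≤ (s + 1)(B + 5)`. [folklore] -/
theorem exists_subst_of_formulaComplexity_le (q : MvPolynomial ι F) {s : ℕ}
    (hs : formulaComplexity q ≤ s) (θ : ι → PatternExpr F k l) {B : ℕ} (hθ : ∀ i, (θ i).length ≤ B)
    (hB : 1 ≤ B) :
    ∃ e : PatternExpr F k l, e.length ≤ (s + 1) * (B + 5) ∧
      ∀ (n : ℕ) (ρ : Fin k → Fin n) (γ : Fin l → Fin n),
        e.value n ρ γ = aeval (fun i => (θ i).value n ρ γ) q := by
  obtain ⟨w, hw, hws⟩ := exists_wexpr_size_le_formulaComplexity q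
  obtain ⟨e, hl, hv⟩ := exists_subst θ hθ hB w
  refine ⟨e, hl.trans ?_, fun n ρ γ => by rw [hv, hw]⟩
  have hsz : w.size ≤ s := hws.trans hs
  calc 5 * w.size + (w.size + 1) * B ≤ 5 * s + (s + 1) * B := by
        have := Nat.mul_le_mul_right B (Nat.add_le_add_right hsz 1)
        omega
    _ ≤ (s + 1) * (B + 5) := by ring_nf; omega

end SingleLevel

/-! ### Family level: `VQP` families substitute at quasi-polynomial length -/

section Family

/-- Arithmetic: `(s + 1)(B + 5)` is quasi-polynomial when `s` and `B` are. [folklore] -/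
theorem qp_subst_bound (a b : ℕ) : ∃ c : ℕ, ∀ L s B : ℕ, s ≤ 2 ^ ((L + a) ^ a) →
    B ≤ 2 ^ ((L + b) ^ b) → (s + 1) * (B + 5) ≤ 2 ^ ((L + c) ^ c) := by
  obtain ⟨c₁, hc₁⟩ := NarrowClosure.qp_combine b 0
  obtain ⟨c₂, hc₂⟩ := NarrowClosure.qp_combine a c₁
  refine ⟨c₂, fun L s B hs hB => ?_⟩
  have h1 : (B + 2) * (1 + 2) ≤ 2 ^ ((L + c₁) ^ c₁) := hc₁ L B 1 hB (by simp)
  have h2 : 3 * B + 4 ≤ 2 ^ ((L + c₁) ^ c₁) := by omega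
  have h3 := hc₂ L s (3 * B + 4) hs h2
  calc (s + 1) * (B + 5) ≤ (s + 2) * (3 * B + 4 + 2) := Nat.mul_le_mul (by omega) (by omega)
    _ ≤ 2 ^ ((L + c₂) ^ c₂) := h3

/-- ★ **`VQP` substitution principle** (the complexity half of `VP` at work, via BCS (21.33)
`VQP_e = VQP`, discharged in the tree): for a `VQP` family `Q_n ∈ ℂ[y_1, …, y_{m(n)}]` and substituends
`θ_n i` (pattern expressions with `k n` row and `l n` column labels) of quasi-polynomial length, uniformly
in `n ≥ 1` there is ONE pattern expression of quasi-polynomial length whose value at every label assignment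
is `Q_n(θ_n)` there. [cite: BurgisserClausenShokrollahi1997, Thm. (21.33)] -/
theorem exists_narrow_subst_of_isVQPFamily {m : ℕ → ℕ} (Q : (n : ℕ) → MvPolynomial (Fin (m n)) ℂ)
    (hQ : IsVQPFamily Q) {k l : ℕ → ℕ} (θ : (n : ℕ) → Fin (m n) → PatternExpr ℂ (k n) (l n))
    (hθ : ∃ c : ℕ, ∀ n : ℕ, 1 ≤ n → ∀ i, (θ n i).length ≤ 2 ^ ((Nat.log 2 n + c) ^ c)) :
    ∃ c : ℕ, ∀ n : ℕ, 1 ≤ n → ∃ e : PatternExpr ℂ (k n) (l n),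
      e.length ≤ 2 ^ ((Nat.log 2 n + c) ^ c) ∧
      ∀ (ρ : Fin (k n) → Fin n) (γ : Fin (l n) → Fin n),
        e.value n ρ γ = aeval (fun i => (θ n i).value n ρ γ) (Q n) := by
  obtain ⟨a, ha⟩ := ((isVQPeFamily_iff_isVQPFamily ℂ (fun n => Fin (m n)) Q).2 hQ).2
  obtain ⟨b, hb⟩ := hθ
  obtain ⟨c, hc⟩ := qp_subst_bound a b
  refine ⟨c, fun n hn => ?_⟩
  obtain ⟨e, hl, hv⟩ := exists_subst_of_formulaComplexity_le (Q n) (ha n) (θ n) (hb n hn)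
    Nat.one_le_two_pow
  exact ⟨e, hl.trans (hc _ _ _ le_rfl le_rfl), hv n⟩

/-- The `VP` case (`VP ⊆ VQP`, `IsVPFamily.isVQPFamily`). [cite: BurgisserClausenShokrollahi1997, §21.5] -/
theorem exists_narrow_subst_of_isVPFamily {m : ℕ → ℕ} (Q : (n : ℕ) → MvPolynomial (Fin (m n)) ℂ)
    (hQ : IsVPFamily Q) {k l : ℕ → ℕ} (θ : (n : ℕ) → Fin (m n) → PatternExpr ℂ (k n) (l n))
    (hθ : ∃ c : ℕ, ∀ n : ℕ, 1 ≤ n → ∀ i, (θ n i).length ≤ 2 ^ ((Nat.log 2 n + c) ^ c)) :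
    ∃ c : ℕ, ∀ n : ℕ, 1 ≤ n → ∃ e : PatternExpr ℂ (k n) (l n),
      e.length ≤ 2 ^ ((Nat.log 2 n + c) ^ c) ∧
      ∀ (ρ : Fin (k n) → Fin n) (γ : Fin (l n) → Fin n),
        e.value n ρ γ = aeval (fun i => (θ n i).value n ρ γ) (Q n) :=
  exists_narrow_subst_of_isVQPFamily Q hQ.isVQPFamily θ hθ

end Family

/-! ### The power-sum substituends and the one-row stratum -/

section PowerSums

variable {F : Type} [CommSemiring F]

/-- Powers of an edge: an expression of length `2 j + 1` with value `x_{ρ a, γ b}^j`. [folklore] -/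
theorem exists_edge_pow {k l : ℕ} (a : Fin k) (b : Fin l) (j : ℕ) :
    ∃ e : PatternExpr F k l, e.length = 2 * j + 1 ∧
      ∀ (n : ℕ) (ρ : Fin k → Fin n) (γ : Fin l → Fin n), e.value n ρ γ = X (ρ a, γ b) ^ j := by
  induction j with
  | zero => exact ⟨PatternExpr.const 1, rfl, fun n ρ γ => by simp⟩
  | succ j ih =>
    obtain ⟨e, hl, hv⟩ := ih
    exact ⟨PatternExpr.mul (PatternExpr.edge a b) e, by simp [PatternExpr.length, hl]; ring,
      fun n ρ γ => by simp [hv, pow_succ']⟩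

/-- Row power sums: with one row label and one column label, an expression of length `2 j + 2` whose
value at `(ρ, γ)` is `p_j(row ρ 0) = Σ_v x_{ρ 0, v}^j` (independent of `γ`). [folklore] -/
theorem exists_rowPowerSum (j : ℕ) :
    ∃ e : PatternExpr F 1 1, e.length = 2 * j + 2 ∧
      ∀ (n : ℕ) (ρ : Fin 1 → Fin n) (γ : Fin 1 → Fin n),
        e.value n ρ γ = ∑ v : Fin n, X (ρ 0, v) ^ j := by
  obtain ⟨e, hl, hv⟩ := exists_edge_pow (F := F) (0 : Fin 1) (0 : Fin 1) j
  exact ⟨PatternExpr.sumCol 0 e, by simp [PatternExpr.length, hl], fun n ρ γ => by simp [hv]⟩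

/-- Full power sums: an expression of length `2 j + 3` whose value is `P_j = Σ_{u,v} x_{uv}^j`
(independent of the assignment). [folklore] -/
theorem exists_fullPowerSum (j : ℕ) :
    ∃ e : PatternExpr F 1 1, e.length = 2 * j + 3 ∧
      ∀ (n : ℕ) (ρ : Fin 1 → Fin n) (γ : Fin 1 → Fin n),
        e.value n ρ γ = ∑ u : Fin n, ∑ v : Fin n, X (u, v) ^ j := by
  obtain ⟨e, hl, hv⟩ := exists_rowPowerSum (F := F) j
  exact ⟨PatternExpr.sumRow 0 e, by simp [PatternExpr.length, hl], fun n ρ γ => by simp [hv]⟩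

end PowerSums

section Strata

open Literature.Computability.AlgebraicComplexity

/-- Closing an expression with one row and one column label whose value does not depend on the
assignment: `close n e = n² · v`. [folklore] -/
theorem close_eq_of_value_const (n : ℕ) (e : PatternExpr ℂ 1 1) (v : MvPolynomial (Fin n × Fin n) ℂ)
    (hv : ∀ (ρ : Fin 1 → Fin n) (γ : Fin 1 → Fin n), e.value n ρ γ = v) :
    e.close n = ((n : ℂ) ^ 2) • v := by
  unfold PatternExpr.close
  simp only [hv, Finset.sum_const, Finset.card_univ, Fintype.card_fun, Fintype.card_fin, pow_one,
    smul_smul, ← Nat.cast_smul_eq_nsmul ℂ]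
  congr 1
  ring

/-- Normalising the factor `n²` away at `n ≥ 1`: an expression of length `|e| + 2` closing to `v`. [folklore] -/
theorem exists_close_eq_of_value_const {n : ℕ} (hn : 1 ≤ n) (e : PatternExpr ℂ 1 1)
    (v : MvPolynomial (Fin n × Fin n) ℂ)
    (hv : ∀ (ρ : Fin 1 → Fin n) (γ : Fin 1 → Fin n), e.value n ρ γ = v) :
    ∃ e' : PatternExpr ℂ 1 1, e'.length = e.length + 2 ∧ e'.close n = v := by
  refine ⟨PatternExpr.mul (PatternExpr.const (((n : ℂ) ^ 2)⁻¹)) e,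
    by simp [PatternExpr.length]; ring, ?_⟩
  have hn' : ((n : ℂ) ^ 2) ≠ 0 := pow_ne_zero 2 (by exact_mod_cast (show n ≠ 0 by omega))
  rw [ShortClose.close_const_mul, close_eq_of_value_const n e v hv, smul_smul, inv_mul_cancel₀ hn',
    one_smul]

/-- ★ **The one-row stratum in power-sum coordinates is narrow of quasi-polynomial length.**  For every
`VQP` family `Q_n ∈ ℂ[y_1, …, y_{m(n)}]`, the matrix-symmetric family
`f_n = Σ_i Q_n(p_1(row i), …, p_{m(n)}(row i))`, `p_j(row i) = Σ_{j'} x_{ij'}^j`, satisfies the conclusion of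
`stub_narrowExpressionCompression` (with `k = l = 1`).  (Bläser–Jindal 2019 Thm 4 + Newton's identities put
every `Σ_i g_n(row i)`, `g_n` symmetric `VP`, in this form with `Q ∈ VP` — not used here.)
[cite: BurgisserClausenShokrollahi1997, Thm. (21.33)] -/
theorem narrowQP_rowPowerSumSubst {m : ℕ → ℕ} (Q : (n : ℕ) → MvPolynomial (Fin (m n)) ℂ)
    (hQ : IsVQPFamily Q) :
    ∃ c : ℕ, ∀ n : ℕ, 1 ≤ n → ∃ (k l : ℕ) (e : PatternExpr ℂ k l),
      n ^ (k + l) ≤ 2 ^ ((Nat.log 2 n + c) ^ c) ∧ e.length ≤ 2 ^ ((Nat.log 2 n + c) ^ c) ∧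
      e.close n = ∑ i : Fin n, aeval (fun j : Fin (m n) =>
        ∑ v : Fin n, (X (i, v) : MvPolynomial (Fin n × Fin n) ℂ) ^ (j.val + 1)) (Q n) := by
  classical
  -- the substituends: row power sums, length `2 (j + 1) + 2 ≤ 2 m(n) + 4`, p-bounded hence qp
  choose θ hθl hθv using fun j : ℕ => exists_rowPowerSum (F := ℂ) j
  obtain ⟨a, ha⟩ := hQ.1.1
  have hθ : ∃ c : ℕ, ∀ n : ℕ, 1 ≤ n → ∀ i : Fin (m n),
      (θ (i.val + 1)).length ≤ 2 ^ ((Nat.log 2 n + c) ^ c) := by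
    obtain ⟨c, hc⟩ := NarrowClosure.qp_combine (a + 1) 0
    refine ⟨c, fun n _ i => ?_⟩
    have hm : m n ≤ n ^ a + a := by simpa using ha n
    have h1 : n ^ a + a ≤ 2 ^ ((Nat.log 2 n + (a + 1)) ^ (a + 1)) := CompressionFloors.pbounded_le_qp n a
    have h2 := hc (Nat.log 2 n) (n ^ a + a) 0 h1 (by simp)
    rw [hθl]
    have hi : i.val < m n := i.isLt
    nlinarith
  obtain ⟨c₁, hc₁⟩ := exists_narrow_subst_of_isVQPFamily Q hQ (k := fun _ => 1) (l := fun _ => 1)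
    (fun n i => θ (i.val + 1)) hθ
  obtain ⟨c₂, hc₂⟩ := NarrowClosure.qp_combine c₁ 0
  refine ⟨max c₂ 3, fun n hn => ?_⟩
  obtain ⟨e, hl, hv⟩ := hc₁ n hn
  -- sum out the row label; the value is then constant in the assignment
  set g : Fin n → MvPolynomial (Fin n × Fin n) ℂ := fun i => aeval (fun j : Fin (m n) =>
    ∑ v : Fin n, (X (i, v) : MvPolynomial (Fin n × Fin n) ℂ) ^ (j.val + 1)) (Q n) with hg
  have hval : ∀ (ρ : Fin 1 → Fin n) (γ : Fin 1 → Fin n),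
      (PatternExpr.sumRow 0 e).value n ρ γ = ∑ i : Fin n, g i := by
    intro ρ γ
    simp only [PatternExpr.value_sumRow, hv, hθv, Function.update_self, hg]
  obtain ⟨e', hl', hc'⟩ := exists_close_eq_of_value_const hn (PatternExpr.sumRow 0 e) _ hval
  refine ⟨1, 1, e', ?_, ?_, hc'⟩
  · calc n ^ (1 + 1) ≤ n ^ 2 + 2 := by norm_num
      _ ≤ 2 ^ ((Nat.log 2 n + 3) ^ 3) := CompressionFloors.pbounded_le_qp n 2
      _ ≤ 2 ^ ((Nat.log 2 n + max c₂ 3) ^ max c₂ 3) :=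
          Nat.pow_le_pow_right (by norm_num) (CompressionFloors.polylog_mono (le_max_right _ _))
  · have h := hc₂ (Nat.log 2 n) e.length 0 hl (by simp)
    calc e'.length = e.length + 3 := by rw [hl']; simp [PatternExpr.length]
      _ ≤ (e.length + 2) * (0 + 2) := by omega
      _ ≤ 2 ^ ((Nat.log 2 n + c₂) ^ c₂) := h
      _ ≤ 2 ^ ((Nat.log 2 n + max c₂ 3) ^ max c₂ 3) :=
          Nat.pow_le_pow_right (by norm_num) (CompressionFloors.polylog_mono (le_max_left _ _))

/-- **The fully symmetric stratum**: `f_n = Q_n(P_1, …, P_{m(n)})`, `P_j = Σ_{u,v} x_{uv}^j`, is narrow of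
quasi-polynomial length for every `VQP` family `Q`. [cite: BurgisserClausenShokrollahi1997, Thm. (21.33)] -/
theorem narrowQP_fullPowerSumSubst {m : ℕ → ℕ} (Q : (n : ℕ) → MvPolynomial (Fin (m n)) ℂ)
    (hQ : IsVQPFamily Q) :
    ∃ c : ℕ, ∀ n : ℕ, 1 ≤ n → ∃ (k l : ℕ) (e : PatternExpr ℂ k l),
      n ^ (k + l) ≤ 2 ^ ((Nat.log 2 n + c) ^ c) ∧ e.length ≤ 2 ^ ((Nat.log 2 n + c) ^ c) ∧
      e.close n = aeval (fun j : Fin (m n) =>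
        ∑ u : Fin n, ∑ v : Fin n, (X (u, v) : MvPolynomial (Fin n × Fin n) ℂ) ^ (j.val + 1)) (Q n) := by
  classical
  choose θ hθl hθv using fun j : ℕ => exists_fullPowerSum (F := ℂ) j
  obtain ⟨a, ha⟩ := hQ.1.1
  have hθ : ∃ c : ℕ, ∀ n : ℕ, 1 ≤ n → ∀ i : Fin (m n),
      (θ (i.val + 1)).length ≤ 2 ^ ((Nat.log 2 n + c) ^ c) := by
    obtain ⟨c, hc⟩ := NarrowClosure.qp_combine (a + 1) 0
    refine ⟨c, fun n _ i => ?_⟩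
    have hm : m n ≤ n ^ a + a := by simpa using ha n
    have h1 : n ^ a + a ≤ 2 ^ ((Nat.log 2 n + (a + 1)) ^ (a + 1)) := CompressionFloors.pbounded_le_qp n a
    have h2 := hc (Nat.log 2 n) (n ^ a + a) 0 h1 (by simp)
    rw [hθl]
    have hi : i.val < m n := i.isLt
    nlinarith
  obtain ⟨c₁, hc₁⟩ := exists_narrow_subst_of_isVQPFamily Q hQ (k := fun _ => 1) (l := fun _ => 1)
    (fun n i => θ (i.val + 1)) hθ
  obtain ⟨c₂, hc₂⟩ := NarrowClosure.qp_combine c₁ 0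
  refine ⟨max c₂ 3, fun n hn => ?_⟩
  obtain ⟨e, hl, hv⟩ := hc₁ n hn
  have hval : ∀ (ρ : Fin 1 → Fin n) (γ : Fin 1 → Fin n),
      e.value n ρ γ = aeval (fun j : Fin (m n) =>
        ∑ u : Fin n, ∑ v : Fin n, (X (u, v) : MvPolynomial (Fin n × Fin n) ℂ) ^ (j.val + 1)) (Q n) := by
    intro ρ γ
    simp only [hv, hθv]
  obtain ⟨e', hl', hc'⟩ := exists_close_eq_of_value_const hn e _ hval
  refine ⟨1, 1, e', ?_, ?_, hc'⟩
  · calc n ^ (1 + 1) ≤ n ^ 2 + 2 := by norm_num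
      _ ≤ 2 ^ ((Nat.log 2 n + 3) ^ 3) := CompressionFloors.pbounded_le_qp n 2
      _ ≤ 2 ^ ((Nat.log 2 n + max c₂ 3) ^ max c₂ 3) :=
          Nat.pow_le_pow_right (by norm_num) (CompressionFloors.polylog_mono (le_max_right _ _))
  · have h := hc₂ (Nat.log 2 n) e.length 0 hl (by simp)
    calc e'.length = e.length + 2 := hl'
      _ ≤ (e.length + 2) * (0 + 2) := by omega
      _ ≤ 2 ^ ((Nat.log 2 n + c₂) ^ c₂) := h
      _ ≤ 2 ^ ((Nat.log 2 n + max c₂ 3) ^ max c₂ 3) :=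
          Nat.pow_le_pow_right (by norm_num) (CompressionFloors.polylog_mono (le_max_left _ _))

end Strata

end FormulaSubstitution

end Summit.ValiantsHypothesis.ValiantsHypothesis.Theorems

end
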